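import Literature.Analysis.Complex.OneSidedPowerSum
import HarnessLib

/-!
# The one-sided power sum inequality for summable families

Topic `Literature/Analysis/Complex`, namespace `Literature.Analysis.Complex.PowerSum` (continuation of
`OneSidedPowerSum.lean`, the Finset version `exists_re_powerSum_ge`).  Everything here is PROVED.

Lagarias–Montgomery–Odlyzko / Zaman state the inequality for an infinite sequence `z₁, z₂, …` with
`Σ |z_n| < ∞` and `|z_n| ≤ |z₁|`; the tree's Finset version is extended here by truncation:

* `exists_max_node` — in a summable weighted family (weights `b_j = 0` or `≥ 1`) containing a node with
  `b > 0`, `z ≠ 0`, some node of positive weight has maximal modulus among the nodes of positive weight;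
* `exists_re_tsum_powerSum_ge` — for `b_j ≥ 0`, `Σ_j b_j|z_j| < ∞`, `b_{j₀} > 0`, `z_{j₀} ≠ 0`,
  `|z_j| ≤ |z_{j₀}|` whenever `b_j > 0`, and `ε > 0`: there is `m ∈ ℕ`, `1 ≤ m ≤ (12+ε)M`,
  `M = Σ_j b_j|z_j| / (b_{j₀}|z_{j₀}|)`, with `(ε/(96+10ε)) b_{j₀}|z_{j₀}|^m ≤ Re Σ_j b_j z_j^m`
  (half the Finset constant, lost in the truncation). [cite: ThornerZaman2017, Theorem 7.1]

## References

* J. C. Lagarias, H. L. Montgomery, A. M. Odlyzko, Invent. Math. 54 (1979), Thm. 4.2. [LagariasMontgomeryOdlyzko1979]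
* J. Thorner, A. Zaman, Algebra Number Theory 11 (2017), Thm. 7.1. [ThornerZaman2017]
-/

noncomputable section

open Complex Finset Metric Filter Topology

namespace Literature.Analysis.Complex.PowerSum

/-- **A node of maximal modulus exists** in a summable weighted family whose weights are `0` or `≥ 1`,
provided some node has positive weight and is non-zero. [folklore] -/
theorem exists_max_node {ι : Type*} (z : ι → ℂ) (b : ι → ℝ) (hb1 : ∀ j, 0 < b j → 1 ≤ b j)
    (hsum : Summable fun j ↦ b j * ‖z j‖) {j₁ : ι} (hb₁ : 0 < b j₁) (hz₁ : z j₁ ≠ 0) :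
    ∃ j₀, 0 < b j₀ ∧ z j₀ ≠ 0 ∧ ∀ j, 0 < b j → ‖z j‖ ≤ ‖z j₀‖ := by
  classical
  have hR : 0 < ‖z j₁‖ := norm_pos_iff.mpr hz₁
  -- the nodes at least as large as `z j₁` (with positive weight) form a finite set
  have hfin : Set.Finite {j | 0 < b j ∧ ‖z j₁‖ ≤ ‖z j‖} := by
    have ht := hsum.tendsto_cofinite_zero
    have hev : ∀ᶠ j in cofinite, b j * ‖z j‖ < ‖z j₁‖ := ht.eventually (gt_mem_nhds hR)
    refine (Filter.eventually_cofinite.mp hev).subset fun j hj ↦ ?_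
    simp only [Set.mem_setOf_eq, not_lt] at hj ⊢
    calc ‖z j₁‖ ≤ ‖z j‖ := hj.2
      _ = 1 * ‖z j‖ := (one_mul _).symm
      _ ≤ b j * ‖z j‖ := mul_le_mul_of_nonneg_right (hb1 j hj.1) (norm_nonneg _)
  have hne : hfin.toFinset.Nonempty := ⟨j₁, by simp [hb₁]⟩
  obtain ⟨j₀, hj₀, hmax⟩ := hfin.toFinset.exists_max_image (fun j ↦ ‖z j‖) hne
  simp only [Set.Finite.mem_toFinset, Set.mem_setOf_eq] at hj₀ hmax
  refine ⟨j₀, hj₀.1, norm_pos_iff.mp (hR.trans_le hj₀.2), fun j hj ↦ ?_⟩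
  by_cases h : ‖z j₁‖ ≤ ‖z j‖
  · exact hmax j ⟨hj, h⟩
  · push Not at h; exact h.le.trans hj₀.2

/-- **The one-sided power sum inequality for a summable family** (LMO Thm. 4.2 / Thorner–Zaman Thm. 7.1
with weights): `b_j ≥ 0`, `Σ b_j|z_j| < ∞`, `b_{j₀} > 0`, `z_{j₀} ≠ 0`, `|z_j| ≤ |z_{j₀}|` for `b_j > 0`,
`ε > 0`.  Then some `m ∈ ℕ` with `1 ≤ m ≤ (12+ε) Σ_j b_j|z_j| / (b_{j₀}|z_{j₀}|)` has
`(ε/(96+10ε)) b_{j₀}|z_{j₀}|^m ≤ Re Σ_j b_j z_j^m`. [cite: ThornerZaman2017, Theorem 7.1]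
[cite: LagariasMontgomeryOdlyzko1979, Theorem 4.2] -/
theorem exists_re_tsum_powerSum_ge {ι : Type*} (z : ι → ℂ) (b : ι → ℝ) (hb : ∀ j, 0 ≤ b j)
    (hsum : Summable fun j ↦ b j * ‖z j‖) {j₀ : ι} (hb₀ : 0 < b j₀) (hz₀ : z j₀ ≠ 0)
    (hmax : ∀ j, 0 < b j → ‖z j‖ ≤ ‖z j₀‖) {ε : ℝ} (hε : 0 < ε) :
    ∃ m : ℕ, 1 ≤ m ∧ (m : ℝ) ≤ (12 + ε) * ((∑' j, b j * ‖z j‖) / (b j₀ * ‖z j₀‖)) ∧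
      ε / (96 + 10 * ε) * b j₀ * ‖z j₀‖ ^ m ≤ (∑' j, (b j : ℂ) * z j ^ m).re ∧
      Summable (fun j ↦ (b j : ℂ) * z j ^ m) := by
  classical
  set R : ℝ := ‖z j₀‖ with hR
  have hR0 : 0 < R := norm_pos_iff.mpr hz₀
  -- every power is dominated by `b_j |z_j| R^{m-1}` on the support of `b`
  have hdom : ∀ m : ℕ, 1 ≤ m → ∀ j, ‖(b j : ℂ) * z j ^ m‖ ≤ b j * ‖z j‖ * R ^ (m - 1) := by
    intro m hm j
    rw [norm_mul, Complex.norm_real, Real.norm_of_nonneg (hb j), norm_pow]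
    rcases (hb j).eq_or_lt with h0 | hpos
    · rw [← h0]; simp
    · have hle := hmax j hpos
      obtain ⟨m', rfl⟩ := Nat.exists_eq_add_of_le hm
      rw [show 1 + m' - 1 = m' by omega, pow_add, pow_one, mul_assoc]
      gcongr
  have hsm : ∀ m : ℕ, 1 ≤ m → Summable fun j ↦ (b j : ℂ) * z j ^ m := fun m hm ↦
    Summable.of_norm_bounded ((hsum.mul_right (R ^ (m - 1)))) (hdom m hm)
  -- the truncation
  set c : ℝ := ε / (48 + 5 * ε) with hc
  have hc0 : 0 < c := by rw [hc]; positivity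
  set δ : ℝ := c * b j₀ * R / 2 with hδ
  have hδ0 : 0 < δ := by rw [hδ]; positivity
  set T : ℝ := ∑' j, b j * ‖z j‖ with hT
  have ht : Tendsto (fun s : Finset ι ↦ ∑ j ∈ s, b j * ‖z j‖) atTop (𝓝 T) := hsum.hasSum
  obtain ⟨S₀, hS₀⟩ := (ht.eventually (lt_mem_nhds (show T - δ < T by linarith))).exists_forall_of_atTop
  set S : Finset ι := S₀ ∪ {j₀} with hS
  have hj₀S : j₀ ∈ S := by simp [hS]
  have hsplitR := hsum.sum_add_tsum_compl (s := S)
  have htail : ∑' j : ((S : Set ι)ᶜ : Set ι), b j * ‖z (j : ι)‖ < δ := by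
    have := hS₀ S (by simp [hS])
    linarith
  -- the Finset theorem on the support inside `S`
  set S' : Finset ι := S.filter (fun j ↦ 0 < b j) with hS'
  have hj₀S' : j₀ ∈ S' := by simp [hS', hj₀S, hb₀]
  obtain ⟨m, hm1, hmM, hmain⟩ := exists_re_powerSum_ge S' z b (fun j _ ↦ hb j) hj₀S' hb₀
    (fun j hj ↦ hmax j (by simp [hS'] at hj; exact hj.2)) hz₀ hε
  -- sums over `S'` = sums over `S`
  have hSS : ∀ (g : ι → ℂ), ∑ j ∈ S', (b j : ℂ) * g j = ∑ j ∈ S, (b j : ℂ) * g j := by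
    intro g
    rw [hS', Finset.sum_filter]
    refine Finset.sum_congr rfl fun j _ ↦ ?_
    split_ifs with h
    · rfl
    · have : b j = 0 := le_antisymm (not_lt.mp h) (hb j)
      rw [this]; simp
  have hSS' : ∑ j ∈ S', b j * ‖z j‖ = ∑ j ∈ S, b j * ‖z j‖ := by
    rw [hS', Finset.sum_filter]
    refine Finset.sum_congr rfl fun j _ ↦ ?_
    split_ifs with h
    · rfl
    · have : b j = 0 := le_antisymm (not_lt.mp h) (hb j)
      rw [this]; simp
  refine ⟨m, hm1, ?_, ?_, hsm m hm1⟩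
  · -- `M_S ≤ M`
    refine hmM.trans ?_
    rw [hSS']
    gcongr
    exact hsum.sum_le_tsum S (fun j _ ↦ mul_nonneg (hb j) (norm_nonneg _))
  · -- the tail is at most `δ R^{m-1}`
    have hsplit := (hsm m hm1).sum_add_tsum_compl (s := S)
    have htailm : ‖∑' j : ((S : Set ι)ᶜ : Set ι), (b j : ℂ) * z (j : ι) ^ m‖ ≤ δ * R ^ (m - 1) := by
      have hs1 : Summable fun j : ((S : Set ι)ᶜ : Set ι) ↦ ‖(b j : ℂ) * z (j : ι) ^ m‖ :=
        ((hsm m hm1).subtype _).norm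
      have hs2 : Summable fun j : ((S : Set ι)ᶜ : Set ι) ↦ b j * ‖z (j : ι)‖ * R ^ (m - 1) :=
        (hsum.subtype _).mul_right _
      calc ‖∑' j : ((S : Set ι)ᶜ : Set ι), (b j : ℂ) * z (j : ι) ^ m‖
          ≤ ∑' j : ((S : Set ι)ᶜ : Set ι), ‖(b j : ℂ) * z (j : ι) ^ m‖ := norm_tsum_le_tsum_norm hs1
        _ ≤ ∑' j : ((S : Set ι)ᶜ : Set ι), b j * ‖z (j : ι)‖ * R ^ (m - 1) :=
            hs1.tsum_le_tsum (fun j ↦ hdom m hm1 j) hs2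
        _ = (∑' j : ((S : Set ι)ᶜ : Set ι), b j * ‖z (j : ι)‖) * R ^ (m - 1) := tsum_mul_right
        _ ≤ δ * R ^ (m - 1) := by gcongr
    have hre : -(δ * R ^ (m - 1)) ≤ (∑' j : ((S : Set ι)ᶜ : Set ι), (b j : ℂ) * z (j : ι) ^ m).re := by
      have h1 := abs_re_le_norm (∑' j : ((S : Set ι)ᶜ : Set ι), (b j : ℂ) * z (j : ι) ^ m)
      have h2 := neg_abs_le (∑' j : ((S : Set ι)ᶜ : Set ι), (b j : ℂ) * z (j : ι) ^ m).re
      linarith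
    rw [← hsplit, add_re]
    rw [hSS (fun j ↦ z j ^ m), ← hR, ← hc] at hmain
    -- `c b₀ R^m − δ R^{m−1} = (c b₀ R − δ) R^{m−1} = (c b₀ R/2) R^{m−1}`
    obtain ⟨m', rfl⟩ := Nat.exists_eq_add_of_le hm1
    rw [show 1 + m' - 1 = m' by omega] at hre
    have hkey : ε / (96 + 10 * ε) * b j₀ * R ^ (1 + m') = c * b j₀ * R ^ (1 + m') - δ * R ^ m' := by
      rw [hδ, hc, pow_add, pow_one]
      field_simp
      ring
    rw [hkey]
    linarith [hmain, hre]

end Literature.Analysis.Complex.PowerSum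

end
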